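import Summits.AtomisticToContinuum.HydrodynamicLimit.Theses.LindebergRandomFuture
import Summits.AtomisticToContinuum.HydrodynamicLimit.Theorems.LambertianContactSwapLambertianEulerOfHearts
import Summits.AtomisticToContinuum.HydrodynamicLimit.Theses.LambertianContactSwap
import Summits.AtomisticToContinuum.HydrodynamicLimit.Theorems.LambertianContactSwapLambertianEulerArchimedes
import Summits.AtomisticToContinuum.HydrodynamicLimit.Theorems.LambertianContactSwapLambertianEulerLambertLaw
import Summits.AtomisticToContinuum.HydrodynamicLimit.Theorems.LambertianContactSwapLambertianEulerPovzner
import Summits.AtomisticToContinuum.HydrodynamicLimit.Theorems.LambertianContactSwapLambertianEulerPairPovzner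
import Summits.AtomisticToContinuum.HydrodynamicLimit.Theorems.LambertianContactSwapLambertianEulerContactIsotropy
import Summits.AtomisticToContinuum.HydrodynamicLimit.Theorems.LambertianContactSwapLambertianEulerMomentLedgerChain
import Summits.AtomisticToContinuum.HydrodynamicLimit.Theorems.LambertianContactSwapLambertianEulerGibbsInvariance
import Summits.AtomisticToContinuum.HydrodynamicLimit.Theorems.LambertianContactSwapLambertianEulerEntropyToHydro
import Summits.AtomisticToContinuum.HydrodynamicLimit.Theorems.LambertianContactSwapLambertianEulerWindow
import Summits.AtomisticToContinuum.HydrodynamicLimit.Theorems.LambertianContactSwapLambertianEulerMarkov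
import Summits.AtomisticToContinuum.HydrodynamicLimit.Theorems.LambertianContactSwapLambertianEulerIterate
import Summits.AtomisticToContinuum.HydrodynamicLimit.Theorems.LambertianContactSwapLambertianEulerDock
import Summits.AtomisticToContinuum.HydrodynamicLimit.Theorems.LambertianContactSwapLambertianEulerKlLedger
import Summits.AtomisticToContinuum.HydrodynamicLimit.Theorems.LambertianContactSwapLambertianEulerLawSemigroup
import Summits.AtomisticToContinuum.HydrodynamicLimit.Theorems.LambertianContactSwapLambertianEulerDockRf
import Summits.AtomisticToContinuum.HydrodynamicLimit.Theorems.LambertianContactSwapLambertianEulerLambertDirMean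
import Summits.AtomisticToContinuum.HydrodynamicLimit.Theorems.LambertianContactSwapLambertianEulerPairMeanSq
import Summits.AtomisticToContinuum.HydrodynamicLimit.Theorems.LambertianContactSwapLambertianEulerPathwiseProduction
import Summits.AtomisticToContinuum.HydrodynamicLimit.Theorems.LambertianContactSwapLambertianEulerWindowLedger
import Summits.AtomisticToContinuum.HydrodynamicLimit.Theorems.LambertianContactSwapLambertianEulerCollisionCompensator
import Summits.AtomisticToContinuum.HydrodynamicLimit.Theorems.LambertianContactSwapLambertianEulerCompensatedJump
import Summits.AtomisticToContinuum.HydrodynamicLimit.Theorems.LambertianContactSwapLambertianEulerAprioriEntropyBound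
import Summits.AtomisticToContinuum.HydrodynamicLimit.Theorems.LambertianContactSwapLambertianEulerCollisionIntensity
import Summits.AtomisticToContinuum.HydrodynamicLimit.Theorems.LambertianContactSwapLambertianEulerTwoTimeLaw
import Summits.AtomisticToContinuum.HydrodynamicLimit.Theorems.LambertianContactSwapLambertianEulerCollisionBudget
import Summits.AtomisticToContinuum.HydrodynamicLimit.Theorems.LambertianContactSwapLambertianEulerExpectedWindowProductionTools
import Summits.AtomisticToContinuum.HydrodynamicLimit.Theorems.LambertianContactSwapLambertianEulerExpectedWindowProduction
import Summits.AtomisticToContinuum.HydrodynamicLimit.Theorems.LambertianContactSwapLambertianEulerProductionSplit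
import Summits.AtomisticToContinuum.HydrodynamicLimit.Theorems.TwoClocksClampedEntropyClockTimeZeroReference
import Summits.AtomisticToContinuum.HydrodynamicLimit.Theorems.TwoClocksClampedEntropyClockDiscreteEntropyGronwall
import Summits.AtomisticToContinuum.HydrodynamicLimit.Theorems.TwoClocksClampedEntropyClockKlDivLawAtLocalGibbsNeTop
import Summits.AtomisticToContinuum.HydrodynamicLimit.Theorems.ImplosionDichotomyIdealGasImplosionHolds
import Literature.MathematicalPhysics.KineticTheory.LambertianRedrawNondegenerate
import Literature.MathematicalPhysics.KineticTheory.Hilbert6Wave0Proofs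
import Literature.MathematicalPhysics.KineticTheory.HardSphereEulerLLN
import Literature.Barriers.AtomisticToContinuum.HighMomentumCutoff
import Literature.Analysis.FluidPDE.HardSphereAlexander
import HarnessLib

/-! TTRL-lite variant V13078 of stmt-AtomisticToContinuum-11854 -/

namespace Summit.AtomisticToContinuum.HydrodynamicLimit.Theorems

open scoped BigOperators Topology ENNReal InnerProductSpace
open MeasureTheory ProbabilityTheory Filter Set InformationTheory
open Literature.MathematicalPhysics.KineticTheory
open Literature.Analysis.FluidPDE Literature.Analysis.FluidPDE.Alexander
open Summit.AtomisticToContinuum.HydrodynamicLimit.Theses.LambertianContactSwap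
open Summit.AtomisticToContinuum.HydrodynamicLimit.Theorems.ClampedCurrentsDockPathwise (gSum DgSum)

/-- TTRL-lite variant V13078 of `stub_diluteSelfConsistency` (stmt-AtomisticToContinuum-11854) is
**false**: the boundary probe freezes the equation of state at the ideal gas (`σ := 0` inside
`IsHardSphereEulerSolution`, data `(a₀/∫a₀, u₀, θ₀)`) but keeps the packing conclusion
`ρ σ³ < η` with `σ₀` chosen before `T` and the solution, i.e. it asserts that every classical
ideal-gas development of every continuous positive datum has density bounded uniformly over its
interval of existence. The tree's unconditional ideal-gas implosion
`idealGasImplosion_holds : ImplosionDichotomy.IdealGasImplosion` (stmt-AtomisticToContinuum-12588;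
Buckmaster–Cao-Labora–Gómez-Serrano `γ = 5/3` profile on `𝕋³`) supplies profiles and a classical
`σ = 0` solution on `[0, T₁)` with exactly that data and unbounded density; instantiating the
variant at `η = 1`, `σ = σ₀/2` and that solution bounds the density by `(σ₀/2)⁻³` — contradiction.
Witness: the profiles of `IdealGasImplosion`, `η = 1`, `σ = σ₀ / 2`, `M = 1 / (σ₀/2)^3`. -/
theorem stub_diluteSelfConsistency_var13078_false :
    ¬ (∀ η : ℝ, 0 < η → ∀ (a₀ θ₀ : T3 → ℝ) (u₀ : T3 → V3), Continuous a₀ → Continuous θ₀ →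
      Continuous u₀ → (∀ x, 0 < a₀ x) → (∀ x, 0 < θ₀ x) → ∃ σ₀ : ℝ, 0 < σ₀ ∧ ∀ σ : ℝ, 0 < σ →
      σ < σ₀ → ∀ (T : ℝ) (ρ θ : ℝ → T3 → ℝ) (u : ℝ → T3 → V3), IsHardSphereEulerSolution 0 T ρ u θ →
      (∀ x, ρ 0 x = a₀ x / ∫ y, a₀ y) → u 0 = u₀ → θ 0 = θ₀ →
      ∀ t ∈ Set.Ico 0 T, ∀ x, ρ t x * σ ^ 3 < η) := by
  intro h
  obtain ⟨a₀, θ₀, u₀, ha, hθ, hu, ha0, hθ0, T₁, ρ₁, θ₁, u₁, _hT₁, hsol, hρ, hu₁, hθ₁, hunb⟩ :=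
    idealGasImplosion_holds
  obtain ⟨σ₀, hσ₀, hσ⟩ := h 1 one_pos a₀ θ₀ u₀ ha hθ hu ha0 hθ0
  have hs : 0 < σ₀ / 2 := half_pos hσ₀
  have hlt : σ₀ / 2 < σ₀ := half_lt_self hσ₀
  have hb := hσ (σ₀ / 2) hs hlt T₁ ρ₁ θ₁ u₁ hsol hρ hu₁ hθ₁
  have h3 : 0 < (σ₀ / 2) ^ 3 := pow_pos hs 3
  obtain ⟨t, ht, x, hx⟩ := hunb (1 / (σ₀ / 2) ^ 3)
  have h1 : 1 ≤ ρ₁ t x * (σ₀ / 2) ^ 3 := (div_le_iff₀ h3).mp hx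
  have h2 : ρ₁ t x * (σ₀ / 2) ^ 3 < 1 := hb t ht x
  linarith

end Summit.AtomisticToContinuum.HydrodynamicLimit.Theorems
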